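import Literature.Probability.RandomPlanarGeometry.SelfAvoidingWalk
import HarnessLib

/-!
# `EventualTight`, line `Sketch` v7: the virgin-arc atom X2c₁ reduces to FINITE exteriors

Crux stmt-CriticalPhenomena-1372 (`SAWRenewalTightness.EventualTight`; bulk atom X2c₁ = stmt-CriticalPhenomena-17940
`VirginArcTraversalTight` = the registered stub `stub_virginArcTraversalTight` of the line `Sketch`, lead c5).

X2c₁ quantifies over ALL configurations `(H, Λ)` of `ℤ²` that are virgin in the closed lattice disc `B̄(z₀, N)`: the
allowed vertex set `Λ : Set (Site 2)` may be infinite (in the virginization glue V4 it is the complement of two finite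
walks), so the two masses in the inequality `travMass ≤ θ · arcMass` are genuine `tsum`s over possibly infinite arc
types.  This file proves that it is enough to establish X2c₁ for FINITE allowed sets `Λ` (then the arc type is finite
and both masses are finite sums — the form in which induction on the exterior, exact enumeration and certified
numerics are well-typed):

* `tsum_subtype_subtype_mono_of_imp`, `tsum_subtype_mono_of_imp` — shrinking the allowed set shrinks both masses
  (injection of arc types, `ENNReal.tsum_comp_le_tsum_of_injective`);
* `tsum_subtype_subtype_le_iSup_of_cover` — a weighted sum over arcs is bounded by the supremum of the sums over any
  family of sub-configurations that covers every FINITE set of arcs (`ENNReal.tsum_eq_iSup_sum`);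
* `finite_setOf_dist_toComplex_le` — lattice discs are finite;
* `virginArcTraversalTight_of_finite` — **X2c₁ for finite `Λ` implies X2c₁** (conclusion verbatim the registered
  signature): given `(H, Λ)` virgin at `(z₀, N)` with doors `(u,c)`, `(u',c')`, every configuration
  `(H, Λ ∩ B̄(z₀, N+n))`, `n : ℕ`, is finite, virgin at `(z₀, N)` with the same doors, so the finite case bounds its
  traversal mass by `θ ·` (its arc mass) `≤ θ · arcMass(H, Λ)`; and every finite set of `Λ`-arcs lives in one of
  them (an arc has finitely many vertices), so `travMass(H, Λ) = sup_n travMass(H, Λ ∩ B̄(z₀, N+n)) ≤ θ · arcMass(H, Λ)`.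

Nothing here asserts X2c₁; the theorem is a reduction OF the atom (helper, `--supports stmt-CriticalPhenomena-1372`).
-/

noncomputable section

open Set Metric
open scoped ENNReal
open Literature.Probability.RandomPlanarGeometry Literature.Probability.LatticeModels

namespace Summit.CriticalPhenomena.SAWScalingLimit.Theorems

section Generic

variable {W : Type*}

/-- Enlarging the inner predicate of a nested subtype enlarges a weighted `ℝ≥0∞`-sum over it (the obvious
injection). [folklore] -/
theorem tsum_subtype_subtype_mono_of_imp {A A' : W → Prop} (T : W → Prop) (w : W → ℝ≥0∞)
    (h : ∀ p, A p → A' p) :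
    ∑' p : {p : {p : W // A p} // T p.1}, w p.1.1 ≤
      ∑' p : {p : {p : W // A' p} // T p.1}, w p.1.1 := by
  let f : {p : {p : W // A p} // T p.1} → {p : {p : W // A' p} // T p.1} :=
    fun p => ⟨⟨p.1.1, h _ p.1.2⟩, p.2⟩
  have hf : Function.Injective f := by
    rintro ⟨⟨p, hp⟩, ht⟩ ⟨⟨q, hq⟩, ht'⟩ hpq
    have hpq' : p = q := congrArg (fun x => x.1.1) hpq
    subst hpq'
    rfl
  exact ENNReal.tsum_comp_le_tsum_of_injective hf (fun p : {p : {p : W // A' p} // T p.1} => w p.1.1)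

/-- Enlarging the predicate of a subtype enlarges a weighted `ℝ≥0∞`-sum over it. [folklore] -/
theorem tsum_subtype_mono_of_imp {A A' : W → Prop} (w : W → ℝ≥0∞) (h : ∀ p, A p → A' p) :
    ∑' p : {p : W // A p}, w p.1 ≤ ∑' p : {p : W // A' p}, w p.1 := by
  let f : {p : W // A p} → {p : W // A' p} := fun p => ⟨p.1, h _ p.2⟩
  have hf : Function.Injective f := by
    rintro ⟨p, hp⟩ ⟨q, hq⟩ hpq
    have hpq' : p = q := congrArg (fun x => x.1) hpq
    subst hpq'
    rfl
  exact ENNReal.tsum_comp_le_tsum_of_injective hf (fun p : {p : W // A' p} => w p.1)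

/-- **Exhaustion.**  A weighted `ℝ≥0∞`-sum over a nested subtype is at most the supremum of the sums over a family of
inner predicates `A i`, provided every FINITE set of summands satisfies one `A i` (`ENNReal.tsum_eq_iSup_sum` and the
injection of the finite set into the `i`-th subtype). [folklore] -/
theorem tsum_subtype_subtype_le_iSup_of_cover {ι : Type*} (A : ι → W → Prop) (B : W → Prop) (T : W → Prop)
    (w : W → ℝ≥0∞) (hcover : ∀ s : Finset {p : {p : W // B p} // T p.1}, ∃ i, ∀ p ∈ s, A i p.1.1) :
    ∑' p : {p : {p : W // B p} // T p.1}, w p.1.1 ≤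
      ⨆ i, ∑' p : {p : {p : W // A i p} // T p.1}, w p.1.1 := by
  rw [ENNReal.tsum_eq_iSup_sum]
  refine iSup_le fun s => ?_
  obtain ⟨i, hi⟩ := hcover s
  refine le_trans ?_ (le_iSup (fun i => ∑' p : {p : {p : W // A i p} // T p.1}, w p.1.1) i)
  let g : {p // p ∈ s} → {p : {p : W // A i p} // T p.1} :=
    fun p => ⟨⟨p.1.1.1, hi _ p.2⟩, p.1.2⟩
  have hg : Function.Injective g := by
    rintro ⟨⟨⟨p, hp⟩, ht⟩, hs⟩ ⟨⟨⟨q, hq⟩, ht'⟩, hs'⟩ hpq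
    have hpq' : p = q := congrArg (fun x => x.1.1) hpq
    subst hpq'
    rfl
  calc ∑ p ∈ s, w p.1.1 = ∑ p : {p // p ∈ s}, w p.1.1.1 := (Finset.sum_coe_sort s _).symm
    _ = ∑' p : {p // p ∈ s}, w p.1.1.1 := (tsum_fintype _).symm
    _ ≤ ∑' q : {p : {p : W // A i p} // T p.1}, w q.1.1 :=
        ENNReal.tsum_comp_le_tsum_of_injective hg (fun q : {p : {p : W // A i p} // T p.1} => w q.1.1)

end Generic

/-- Lattice discs are finite: the sites of `ℤ²` within distance `r` of a point form a finite set
(`meshVertices_finite` at mesh `1`). [folklore] -/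
theorem finite_setOf_dist_toComplex_le (z₀ : ℂ) (r : ℝ) :
    {v : Site 2 | dist (Site.toComplex v) z₀ ≤ r}.Finite := by
  refine (meshVertices_finite (Ω := Metric.closedBall z₀ r) Metric.isBounded_closedBall one_pos).subset ?_
  intro v hv
  rw [mem_meshVertices_iff, Metric.mem_closedBall]
  simpa [meshPoint] using hv

/-- **X2c₁ reduces to finite exteriors.**  If the virgin-arc traversal bound holds for all configurations with a
FINITE allowed set `Λ` (extra hypothesis `Λ.Finite`; otherwise verbatim the registered atom), then it holds for all
configurations: the conclusion is verbatim the registered signature of `stub_virginArcTraversalTight`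
(= stmt-CriticalPhenomena-17940).  Proof in the module docstring. [folklore] -/
theorem virginArcTraversalTight_of_finite :
    (∀ θ : ℝ, 0 < θ →
      ∃ (k : ℕ) (N₀ : ℝ), 0 < N₀ ∧
        ∀ (H : SimpleGraph (Site 2)) (Λ : Set (Site 2)) (z₀ : ℂ) (N : ℝ) (u c u' c' : Site 2),
          Λ.Finite → N₀ ≤ N →
          (H ≤ zdGraph 2 ∧ (∀ v : Site 2, dist (Site.toComplex v) z₀ ≤ N → v ∈ Λ) ∧
            ∀ v v' : Site 2, dist (Site.toComplex v) z₀ ≤ N + 1 →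
              dist (Site.toComplex v') z₀ ≤ N + 1 → (zdGraph 2).Adj v v' → H.Adj v v') →
          (H.Adj u c ∧ u ∉ Λ ∧ c ∈ Λ ∧ dist (Site.toComplex c) z₀ ≤ N ∧
            N < dist (Site.toComplex u) z₀) →
          (H.Adj u' c' ∧ u' ∉ Λ ∧ c' ∈ Λ ∧ dist (Site.toComplex c') z₀ ≤ N ∧
            N < dist (Site.toComplex u') z₀) →
          ∑' p : {p : {p : H.Walk c c' // p.IsPath ∧ ∀ v ∈ p.support, v ∈ Λ} //
              ∃ ι κ : Fin k → Fin (p.1.support.map Site.toComplex).length, (∀ m, ι m ≤ κ m) ∧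
                (∀ m, (dist ((p.1.support.map Site.toComplex).get (ι m)) z₀ ≤ 2 * N / 5 ∧
                    3 * N / 5 ≤ dist ((p.1.support.map Site.toComplex).get (κ m)) z₀) ∨
                  (3 * N / 5 ≤ dist ((p.1.support.map Site.toComplex).get (ι m)) z₀ ∧
                    dist ((p.1.support.map Site.toComplex).get (κ m)) z₀ ≤ 2 * N / 5)) ∧
                ∀ ⦃m m'⦄, m < m' → κ m ≤ ι m'},
              ENNReal.ofReal (SAW.criticalFugacity ^ p.1.1.length) ≤
            ENNReal.ofReal θ *
              ∑' p : {p : H.Walk c c' // p.IsPath ∧ ∀ v ∈ p.support, v ∈ Λ},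
                ENNReal.ofReal (SAW.criticalFugacity ^ p.1.length)) →
    ∀ θ : ℝ, 0 < θ →
      ∃ (k : ℕ) (N₀ : ℝ), 0 < N₀ ∧
        ∀ (H : SimpleGraph (Site 2)) (Λ : Set (Site 2)) (z₀ : ℂ) (N : ℝ) (u c u' c' : Site 2),
          N₀ ≤ N →
          (H ≤ zdGraph 2 ∧ (∀ v : Site 2, dist (Site.toComplex v) z₀ ≤ N → v ∈ Λ) ∧
            ∀ v v' : Site 2, dist (Site.toComplex v) z₀ ≤ N + 1 →
              dist (Site.toComplex v') z₀ ≤ N + 1 → (zdGraph 2).Adj v v' → H.Adj v v') →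
          (H.Adj u c ∧ u ∉ Λ ∧ c ∈ Λ ∧ dist (Site.toComplex c) z₀ ≤ N ∧
            N < dist (Site.toComplex u) z₀) →
          (H.Adj u' c' ∧ u' ∉ Λ ∧ c' ∈ Λ ∧ dist (Site.toComplex c') z₀ ≤ N ∧
            N < dist (Site.toComplex u') z₀) →
          ∑' p : {p : {p : H.Walk c c' // p.IsPath ∧ ∀ v ∈ p.support, v ∈ Λ} //
              ∃ ι κ : Fin k → Fin (p.1.support.map Site.toComplex).length, (∀ m, ι m ≤ κ m) ∧
                (∀ m, (dist ((p.1.support.map Site.toComplex).get (ι m)) z₀ ≤ 2 * N / 5 ∧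
                    3 * N / 5 ≤ dist ((p.1.support.map Site.toComplex).get (κ m)) z₀) ∨
                  (3 * N / 5 ≤ dist ((p.1.support.map Site.toComplex).get (ι m)) z₀ ∧
                    dist ((p.1.support.map Site.toComplex).get (κ m)) z₀ ≤ 2 * N / 5)) ∧
                ∀ ⦃m m'⦄, m < m' → κ m ≤ ι m'},
              ENNReal.ofReal (SAW.criticalFugacity ^ p.1.1.length) ≤
            ENNReal.ofReal θ *
              ∑' p : {p : H.Walk c c' // p.IsPath ∧ ∀ v ∈ p.support, v ∈ Λ},
                ENNReal.ofReal (SAW.criticalFugacity ^ p.1.length) := by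
  intro hfin θ hθ
  obtain ⟨k, N₀, hN₀, hk⟩ := hfin θ hθ
  refine ⟨k, N₀, hN₀, fun H Λ z₀ N u c u' c' hN hV hD hD' => ?_⟩
  have hNnn : 0 ≤ N := hN₀.le.trans hN
  -- the exhausting family of finite sub-configurations
  let Λ' : ℕ → Set (Site 2) := fun n => Λ ∩ {v : Site 2 | dist (Site.toComplex v) z₀ ≤ N + n}
  have hΛ'fin : ∀ n, (Λ' n).Finite := fun n =>
    (finite_setOf_dist_toComplex_le z₀ (N + n)).subset inter_subset_right
  have hΛ'sub : ∀ n, Λ' n ⊆ Λ := fun n => inter_subset_left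
  -- the finite case on each sub-configuration
  have hstep : ∀ n : ℕ,
      ∑' p : {p : {p : H.Walk c c' // p.IsPath ∧ ∀ v ∈ p.support, v ∈ Λ' n} //
          ∃ ι κ : Fin k → Fin (p.1.support.map Site.toComplex).length, (∀ m, ι m ≤ κ m) ∧
            (∀ m, (dist ((p.1.support.map Site.toComplex).get (ι m)) z₀ ≤ 2 * N / 5 ∧
                3 * N / 5 ≤ dist ((p.1.support.map Site.toComplex).get (κ m)) z₀) ∨
              (3 * N / 5 ≤ dist ((p.1.support.map Site.toComplex).get (ι m)) z₀ ∧
                dist ((p.1.support.map Site.toComplex).get (κ m)) z₀ ≤ 2 * N / 5)) ∧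
            ∀ ⦃m m'⦄, m < m' → κ m ≤ ι m'},
          ENNReal.ofReal (SAW.criticalFugacity ^ p.1.1.length) ≤
        ENNReal.ofReal θ *
          ∑' p : {p : H.Walk c c' // p.IsPath ∧ ∀ v ∈ p.support, v ∈ Λ},
            ENNReal.ofReal (SAW.criticalFugacity ^ p.1.length) := by
    intro n
    have hn : (0 : ℝ) ≤ n := Nat.cast_nonneg n
    refine le_trans (hk H (Λ' n) z₀ N u c u' c' (hΛ'fin n) hN ⟨hV.1, fun v hv => ⟨hV.2.1 v hv, ?_⟩, hV.2.2⟩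
      ⟨hD.1, fun h => hD.2.1 h.1, ⟨hD.2.2.1, ?_⟩, hD.2.2.2.1, hD.2.2.2.2⟩
      ⟨hD'.1, fun h => hD'.2.1 h.1, ⟨hD'.2.2.1, ?_⟩, hD'.2.2.2.1, hD'.2.2.2.2⟩) ?_
    · show dist (Site.toComplex v) z₀ ≤ N + n
      linarith
    · show dist (Site.toComplex c) z₀ ≤ N + n
      linarith [hD.2.2.2.1]
    · show dist (Site.toComplex c') z₀ ≤ N + n
      linarith [hD'.2.2.2.1]
    · exact mul_le_mul' le_rfl
        (tsum_subtype_mono_of_imp (fun p : H.Walk c c' => ENNReal.ofReal (SAW.criticalFugacity ^ p.length))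
          fun p hp => ⟨hp.1, fun v hv => hΛ'sub n (hp.2 v hv)⟩)
  -- every finite set of `Λ`-arcs lives in one sub-configuration
  refine le_trans (tsum_subtype_subtype_le_iSup_of_cover
    (fun (n : ℕ) (p : H.Walk c c') => p.IsPath ∧ ∀ v ∈ p.support, v ∈ Λ' n)
    (fun p : H.Walk c c' => p.IsPath ∧ ∀ v ∈ p.support, v ∈ Λ)
    (fun p : H.Walk c c' => ∃ ι κ : Fin k → Fin (p.support.map Site.toComplex).length, (∀ m, ι m ≤ κ m) ∧
      (∀ m, (dist ((p.support.map Site.toComplex).get (ι m)) z₀ ≤ 2 * N / 5 ∧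
          3 * N / 5 ≤ dist ((p.support.map Site.toComplex).get (κ m)) z₀) ∨
        (3 * N / 5 ≤ dist ((p.support.map Site.toComplex).get (ι m)) z₀ ∧
          dist ((p.support.map Site.toComplex).get (κ m)) z₀ ≤ 2 * N / 5)) ∧
      ∀ ⦃m m'⦄, m < m' → κ m ≤ ι m')
    (fun p : H.Walk c c' => ENNReal.ofReal (SAW.criticalFugacity ^ p.length)) fun s => ?_) (iSup_le hstep)
  -- the cover: a bound on the distances of all vertices of all arcs of `s`
  classical
  let m : Site 2 → ℕ := fun v => ⌈dist (Site.toComplex v) z₀⌉₊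
  let M : {p : {p : H.Walk c c' // p.IsPath ∧ ∀ v ∈ p.support, v ∈ Λ} //
      ∃ ι κ : Fin k → Fin (p.1.support.map Site.toComplex).length, (∀ m, ι m ≤ κ m) ∧
        (∀ m, (dist ((p.1.support.map Site.toComplex).get (ι m)) z₀ ≤ 2 * N / 5 ∧
            3 * N / 5 ≤ dist ((p.1.support.map Site.toComplex).get (κ m)) z₀) ∨
          (3 * N / 5 ≤ dist ((p.1.support.map Site.toComplex).get (ι m)) z₀ ∧
            dist ((p.1.support.map Site.toComplex).get (κ m)) z₀ ≤ 2 * N / 5)) ∧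
        ∀ ⦃m m'⦄, m < m' → κ m ≤ ι m'} → ℕ :=
    fun p => p.1.1.support.toFinset.sup m
  refine ⟨s.sup M, fun p hp => ⟨p.1.2.1, fun v hv => ⟨p.1.2.2 v hv, ?_⟩⟩⟩
  show dist (Site.toComplex v) z₀ ≤ N + (s.sup M : ℕ)
  have h1 : dist (Site.toComplex v) z₀ ≤ m v := Nat.le_ceil _
  have h2 : m v ≤ M p := Finset.le_sup (f := m) (List.mem_toFinset.2 hv)
  have h3 : M p ≤ s.sup M := Finset.le_sup (f := M) hp
  have h4 : (m v : ℝ) ≤ (s.sup M : ℕ) := by exact_mod_cast h2.trans h3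
  linarith

end Summit.CriticalPhenomena.SAWScalingLimit.Theorems

end
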